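import Summits.BirchSwinnertonDyer.BirchSwinnertonDyer.Theorems.BiquadraticEisensteinDescentHeegnerTwistCouplingInSupplyIndefinitePin
import HarnessLib

set_option linter.dupNamespace false -- `Summit.BirchSwinnertonDyer.BirchSwinnertonDyer.Theorems.…` (summit = sub)
set_option autoImplicit false

/-!
# Crux `HeegnerTwistCouplingInSupply` (stmt-BirchSwinnertonDyer-21381) — the ROUNDING PIN (crux idea `rounding-pin-all-p`):
# a `(3,+)`- or `(5,−)`-partner of size `O(√p)` for EVERY prime `p ≡ 3 (mod 4)`, and the trichotomy feeding the `E_p` cell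

Route `BiquadraticEisensteinDescent` (cell `pub/bsd-wall`, width seat `bsd-wall-cm-bed-w2` g13; `--supports` 21381, helper).
Kernel form of the crux idea card `Cruxes/HeegnerTwistCouplingInSupply/Ideas/rounding-pin-all-p.md` (crux-ideate seat 1, g17).
The landed `E_p` corner (`…CornersThreeFacts.exists_cellData_p` → `…CornersEpOneFact.cruxOnEpCorner_of_BT`, `63/64` of the
primes `p ≡ 7 (mod 8)`) needs a CELL DATUM: primes `q ≡ 3 (mod 8)`, `(q/p) = +1` (type `(3,+)`) and `ℓ ≡ 5 (mod 8)`,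
`(ℓ/p) = −1` (type `(5,−)`) with `h(−qℓ) < p`; the ladder takes one partner of size `O(1)` (density loss) because the universal
pins (`threeSquaresPin`: `ℓ < 2p`; `indefinitePinThreePlus`: `q ≤ 10p`) have size `O(p)`. LEVER: round `√(2p)` to its odd
neighbours `z < √(2p) < z + 2`; `M⁻ = 2p − z² ≡ 5`, `M⁺ = (z+2)² − 2p ≡ 3 (mod 8)`, `M⁺ + M⁻ = 4z + 4`. A product of primes
`≡ ±1 (mod 8)` is `≡ ±1`, so each `M^∓` has a prime factor `r ≡ ±3 (mod 8)`; `z² ≡ 2p (mod r)` gives `(2p/r) = +1`, hence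
`(p/r) = −1`, and reciprocity makes `r` a `(3,+)`-partner if `r ≡ 3`, a `(5,−)`-partner if `r ≡ 5 (mod 8)` — ONE useful
partner below `2√(2p) + 2` (★ `roundingPin`; the card's `r² < 9p` form `roundingPin_sq_lt` VERBATIM). TRICHOTOMY
(★ `roundingTrichotomy`): both types among the prime factors of `M⁺M⁻` (`qℓ ≤ 4(⌊√2p⌋+1)²`), or only `(3,+)` — then
`M⁻ ≡ 5 (mod 8)` has factors `≡ 3` AND `≡ 7`, `7q ≤ M⁻ ≤ 4⌊√2p⌋ + 1` — or only `(5,−)` — `7ℓ ≤ M⁺ ≤ 4⌊√2p⌋ − 1`. With the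
complement from the universal pins (the `(3,+)` pin is `q ≤ 3p + 4⌊√2p⌋ + 2` on `p ≡ 7 (mod 8)`: `indefinitePinThreePlus_sharp`,
the family `p = 2r² + 1` of the certificate being empty there) EVERY prime `p ≡ 7 (mod 8)` gets a cell pair with
`7·qℓ ≤ (3p + 4⌊√2p⌋ + 4)(4⌊√2p⌋ + 1)` (★ `exists_cellPair_bound`): `|d| = qℓ = O(p^{3/2})`, inside the reach
`h ≤ π⁻¹√|d| log|d| < p` of the class number formula — consumed by the sequel `…RoundingPinCellData` (cell data and the `E_p`
corner for ALL `p ≡ 7 (mod 8)`). Elementary number theory only (no named fact, no definition); nothing about the crux (all CM `W`;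
residual C⁺), `L`-values or any case of BSD is asserted — BSD is not proved by any of this. Supports stmt-BirchSwinnertonDyer-21381.
-/

namespace Summit.BirchSwinnertonDyer.BirchSwinnertonDyer.Theorems.BiquadraticEisensteinDescentHeegnerTwistCouplingInSupplyRoundingPin

open Summit.BirchSwinnertonDyer.BirchSwinnertonDyer.Theorems.BiquadraticEisensteinDescentHeegnerTwistCouplingInSupplyThreeSquaresPin
  (sq_mod_eight_of_odd)
open Summit.BirchSwinnertonDyer.BirchSwinnertonDyer.Theorems.BiquadraticEisensteinDescentHeegnerTwistCouplingInSupplyIndefinitePin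
  (exists_indefinite_certificate_threePlus)

/-! ## §1 Residues modulo `8`: prime factors in a subgroup of `(ℤ/8)ˣ` -/

/-- **Multiplicative mod-`8` bookkeeping.** If `S ∋ 1` is a set of residues closed under multiplication mod `8` and every prime
factor of the odd number `n` has residue in `S`, then `n mod 8 ∈ S` (induction on the factorisation). [folklore] -/
theorem mod_eight_mem_of_forall_prime {S : Finset ℕ} (h1 : 1 ∈ S) (hmul : ∀ a ∈ S, ∀ b ∈ S, a * b % 8 ∈ S) :
    ∀ n : ℕ, n % 2 = 1 → (∀ r : ℕ, r.Prime → r ∣ n → r % 8 ∈ S) → n % 8 ∈ S := by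
  refine Nat.recOnMul (motive := fun n => n % 2 = 1 → (∀ r : ℕ, r.Prime → r ∣ n → r % 8 ∈ S) → n % 8 ∈ S)
    ?_ ?_ ?_ ?_
  · intro h; exact absurd h (by norm_num)
  · intro _ _; simpa using h1
  · intro r hr _ h; exact h r hr dvd_rfl
  · intro a b ha hb hab h
    obtain ⟨hao, hbo⟩ := Nat.odd_mul.mp (Nat.odd_iff.mpr hab)
    have ha2 : a % 2 = 1 := Nat.odd_iff.mp hao
    have hb2 : b % 2 = 1 := Nat.odd_iff.mp hbo
    have hA := ha ha2 fun r hr hra => h r hr (hra.mul_right b)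
    have hB := hb hb2 fun r hr hrb => h r hr (hrb.mul_left a)
    have := hmul _ hA _ hB
    rwa [Nat.mul_mod a b 8]

/-- A prime factor of an odd number is `≡ 1, 3, 5` or `7 (mod 8)`. [folklore] -/
theorem prime_dvd_odd_mod_eight {n r : ℕ} (hn : n % 2 = 1) (hr : r.Prime) (hrn : r ∣ n) :
    r % 8 = 1 ∨ r % 8 = 3 ∨ r % 8 = 5 ∨ r % 8 = 7 := by
  have hro : r % 2 = 1 := Nat.odd_iff.mp (Odd.of_dvd_nat (Nat.odd_iff.mpr hn) hrn)
  have := hr.two_le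
  omega

/-- **Detecting a prime factor outside a subgroup**: if `S ∋ 1` is closed under multiplication mod `8` and the odd `n` has
`n mod 8 ∉ S`, some prime factor `r` of `n` has `r mod 8 ∉ S`. [folklore] -/
theorem exists_prime_dvd_mod_eight_not_mem {S : Finset ℕ} (h1 : 1 ∈ S) (hmul : ∀ a ∈ S, ∀ b ∈ S, a * b % 8 ∈ S) {n : ℕ}
    (hn2 : n % 2 = 1) (hn : n % 8 ∉ S) : ∃ r : ℕ, r.Prime ∧ r ∣ n ∧ r % 8 ∉ S := by
  by_contra! H
  exact hn (mod_eight_mem_of_forall_prime h1 hmul n hn2 H)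

/-- **A number `≡ ±3 (mod 8)` has a prime factor `≡ 3` or `≡ 5 (mod 8)`** (the subgroup `{1,7}`). [folklore] -/
theorem exists_prime_dvd_mod_eight_three_or_five {n : ℕ} (hn : n % 8 = 3 ∨ n % 8 = 5) :
    ∃ r : ℕ, r.Prime ∧ r ∣ n ∧ (r % 8 = 3 ∨ r % 8 = 5) := by
  obtain ⟨r, hr, hrn, hr8⟩ := exists_prime_dvd_mod_eight_not_mem (S := {1, 7}) (by simp) (by decide) (n := n)
    (by omega) (by simp only [Finset.mem_insert, Finset.mem_singleton]; omega)
  have := prime_dvd_odd_mod_eight (n := n) (by omega) hr hrn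
  simp only [Finset.mem_insert, Finset.mem_singleton] at hr8
  exact ⟨r, hr, hrn, by omega⟩

/-- **Trichotomy half: `n ≡ 5 (mod 8)` with no prime factor `≡ 5 (mod 8)` has prime factors `q ≡ 3` and `s ≡ 7 (mod 8)`**
(subgroups `{1,7}` and `{1,3}`). [folklore] -/
theorem exists_prime_dvd_three_and_seven {n : ℕ} (hn : n % 8 = 5) (h5 : ∀ r : ℕ, r.Prime → r ∣ n → r % 8 ≠ 5) :
    ∃ q s : ℕ, q.Prime ∧ q ∣ n ∧ q % 8 = 3 ∧ s.Prime ∧ s ∣ n ∧ s % 8 = 7 := by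
  obtain ⟨q, hq, hqn, hq8⟩ := exists_prime_dvd_mod_eight_not_mem (S := {1, 7}) (by simp) (by decide) (n := n)
    (by omega) (by simp only [Finset.mem_insert, Finset.mem_singleton]; omega)
  obtain ⟨s, hs, hsn, hs8⟩ := exists_prime_dvd_mod_eight_not_mem (S := {1, 3}) (by simp) (by decide) (n := n)
    (by omega) (by simp only [Finset.mem_insert, Finset.mem_singleton]; omega)
  have hq' := prime_dvd_odd_mod_eight (n := n) (by omega) hq hqn
  have hs' := prime_dvd_odd_mod_eight (n := n) (by omega) hs hsn
  have := h5 q hq hqn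
  have := h5 s hs hsn
  simp only [Finset.mem_insert, Finset.mem_singleton] at hq8 hs8
  exact ⟨q, s, hq, hqn, by omega, hs, hsn, by omega⟩

/-- **Trichotomy half: `n ≡ 3 (mod 8)` with no prime factor `≡ 3 (mod 8)` has prime factors `ℓ ≡ 5` and `s ≡ 7 (mod 8)`**
(subgroups `{1,7}` and `{1,5}`). [folklore] -/
theorem exists_prime_dvd_five_and_seven {n : ℕ} (hn : n % 8 = 3) (h3 : ∀ r : ℕ, r.Prime → r ∣ n → r % 8 ≠ 3) :
    ∃ l s : ℕ, l.Prime ∧ l ∣ n ∧ l % 8 = 5 ∧ s.Prime ∧ s ∣ n ∧ s % 8 = 7 := by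
  obtain ⟨l, hl, hln, hl8⟩ := exists_prime_dvd_mod_eight_not_mem (S := {1, 7}) (by simp) (by decide) (n := n)
    (by omega) (by simp only [Finset.mem_insert, Finset.mem_singleton]; omega)
  obtain ⟨s, hs, hsn, hs8⟩ := exists_prime_dvd_mod_eight_not_mem (S := {1, 5}) (by simp) (by decide) (n := n)
    (by omega) (by simp only [Finset.mem_insert, Finset.mem_singleton]; omega)
  have hl' := prime_dvd_odd_mod_eight (n := n) (by omega) hl hln
  have hs' := prime_dvd_odd_mod_eight (n := n) (by omega) hs hsn
  have := h3 l hl hln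
  have := h3 s hs hsn
  simp only [Finset.mem_insert, Finset.mem_singleton] at hl8 hs8
  exact ⟨l, s, hl, hln, by omega, hs, hsn, by omega⟩

/-- Two distinct primes dividing `n > 0` with the second `≥ 7`: `7·q ≤ n`. [folklore] -/
theorem seven_mul_le_of_dvd_of_dvd {n q s : ℕ} (hn : 0 < n) (hq : q.Prime) (hs : s.Prime) (hqs : q ≠ s) (h7 : 7 ≤ s)
    (hqn : q ∣ n) (hsn : s ∣ n) : 7 * q ≤ n := by
  have hcop : Nat.Coprime q s := (Nat.coprime_primes hq hs).mpr hqs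
  have hle : q * s ≤ n := Nat.le_of_dvd hn (hcop.mul_dvd_of_dvd_of_dvd hqn hsn)
  calc 7 * q ≤ s * q := Nat.mul_le_mul_right q h7
    _ = q * s := Nat.mul_comm s q
    _ ≤ n := hle

/-! ## §2 The symbol of a prime factor `r ≡ ±3 (mod 8)` of `|z² − 2p|` -/

/-- **`(p/r) = −1`** for an odd prime `p`, a prime `r ≡ 3` or `5 (mod 8)` dividing `M = |z² − 2p|` with `0 < z < p`:
`z² ≡ 2p (mod r)` and `r ∤ 2p` (as `r ≠ 2`, and `r = p` would give `p ∣ z`) make `2p` a non-zero square mod `r`, so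
`(2p/r) = +1`, and `(2/r) = −1`. [folklore] -/
theorem jacobiSym_eq_neg_one_of_dvd_sq_sub_two_mul {p r z M : ℕ} (hp : p.Prime) (hp2 : p % 2 = 1) (hr : r.Prime)
    (hr8 : r % 8 = 3 ∨ r % 8 = 5) (hM : z * z + M = 2 * p ∨ 2 * p + M = z * z) (hrM : r ∣ M) (hz0 : 0 < z)
    (hzp : z < p) : jacobiSym (p : ℤ) r = -1 := by
  haveI : Fact r.Prime := ⟨hr⟩
  have hr2 : r ≠ 2 := by rintro rfl; omega
  have hrp : r ≠ p := by
    rintro rfl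
    have hrz2 : r ∣ z * z := by
      rcases hM with h | h
      · have : r ∣ z * z + M := by rw [h]; exact Dvd.intro_left _ rfl
        exact (Nat.dvd_add_right hrM).mp (by rwa [Nat.add_comm] at this)
      · have h2 : r ∣ 2 * r + M := Nat.dvd_add (Dvd.intro_left _ rfl) hrM
        rwa [h] at h2
    have hrz : r ∣ z := by
      rcases (Nat.Prime.dvd_mul hr).mp hrz2 with h | h <;> exact h
    exact absurd (Nat.le_of_dvd hz0 hrz) (not_le.mpr hzp)
  -- `(2p : ZMod r)` is a non-zero square
  have hzero : ((M : ℕ) : ZMod r) = 0 := (ZMod.natCast_eq_zero_iff _ _).mpr hrM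
  have hsq : IsSquare (((2 : ℤ) * (p : ℤ) : ℤ) : ZMod r) := by
    refine ⟨(z : ZMod r), ?_⟩
    rcases hM with h | h
    · have hcast : ((z * z + M : ℕ) : ZMod r) = ((2 * p : ℕ) : ZMod r) := by rw [h]
      push_cast at hcast ⊢
      linear_combination -hcast + hzero
    · have hcast : ((2 * p + M : ℕ) : ZMod r) = ((z * z : ℕ) : ZMod r) := by rw [h]
      push_cast at hcast ⊢
      linear_combination hcast - hzero
  have hne : (((2 : ℤ) * (p : ℤ) : ℤ) : ZMod r) ≠ 0 := by
    have hndvd : ¬ r ∣ 2 * p := by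
      intro h
      rcases (Nat.Prime.dvd_mul hr).mp h with h | h
      · exact hr2 ((Nat.prime_dvd_prime_iff_eq hr Nat.prime_two).mp h)
      · exact hrp ((Nat.prime_dvd_prime_iff_eq hr hp).mp h)
    intro h
    apply hndvd
    apply (ZMod.natCast_eq_zero_iff (2 * p) r).mp
    push_cast
    exact_mod_cast h
  have h1 : legendreSym r ((2 : ℤ) * (p : ℤ)) = 1 := (legendreSym.eq_one_iff r hne).mpr hsq
  rw [legendreSym.mul, legendreSym.at_two hr2, ZMod.χ₈_nat_eq_if_mod_eight, if_neg (by omega),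
    if_neg (by omega)] at h1
  have h2 : legendreSym r p = -1 := by linarith
  rw [← jacobiSym.legendreSym.to_jacobiSym, h2]

/-- **The type of a rounding prime.** In the situation of `jacobiSym_eq_neg_one_of_dvd_sq_sub_two_mul` with `p ≡ 3 (mod 4)`:
`r ≡ 3 (mod 8) ⇒ (r/p) = +1` (type `(3,+)`, reciprocity at two primes `≡ 3 (mod 4)`) and `r ≡ 5 (mod 8) ⇒ (r/p) = −1`
(type `(5,−)`, reciprocity at `r ≡ 1 (mod 4)`). [folklore] -/
theorem type_of_dvd_sq_sub_two_mul {p r z M : ℕ} (hp : p.Prime) (hp4 : p % 4 = 3) (hr : r.Prime)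
    (hr8 : r % 8 = 3 ∨ r % 8 = 5) (hM : z * z + M = 2 * p ∨ 2 * p + M = z * z) (hrM : r ∣ M) (hz0 : 0 < z)
    (hzp : z < p) : (r % 8 = 3 ∧ jacobiSym (r : ℤ) p = 1) ∨ (r % 8 = 5 ∧ jacobiSym (r : ℤ) p = -1) := by
  have hpr := jacobiSym_eq_neg_one_of_dvd_sq_sub_two_mul hp (by omega) hr hr8 hM hrM hz0 hzp
  rcases hr8 with h3 | h5
  · left
    refine ⟨h3, ?_⟩
    rw [jacobiSym.quadratic_reciprocity_three_mod_four (by omega) hp4, hpr]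
    norm_num
  · right
    refine ⟨h5, ?_⟩
    rw [jacobiSym.quadratic_reciprocity_one_mod_four (by omega) (Nat.odd_iff.mpr (by omega)), hpr]

/-! ## §3 The odd neighbours of `√(2p)` and the rounding pin -/

/-- Squares are `≢ 6 (mod 8)`. [folklore] -/
theorem mul_self_mod_eight_ne_six (s : ℕ) : s * s % 8 ≠ 6 := by
  have h : ∀ a < 8, a * a % 8 ≠ 6 := by decide
  rw [Nat.mul_mod]
  exact h (s % 8) (Nat.mod_lt s (by norm_num))

/-- **The odd neighbours of `√(2p)`.** For a prime `p ≡ 3 (mod 4)`, `p ≥ 7`: an odd `z` with `z² < 2p < (z+2)²`; writing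
`M⁻ = 2p − z²`, `M⁺ = (z+2)² − 2p`: `M⁻ ≡ 5`, `M⁺ ≡ 3 (mod 8)`, `M⁺ + M⁻ = 4z + 4`, `z ≤ ⌊√(2p)⌋`, `0 < z` and `z + 2 < p`.
[folklore] -/
theorem exists_odd_neighbours {p : ℕ} (hp4 : p % 4 = 3) (h7 : 7 ≤ p) :
    ∃ z Mm Mp : ℕ, z % 2 = 1 ∧ z * z + Mm = 2 * p ∧ 2 * p + Mp = (z + 2) * (z + 2) ∧ Mm % 8 = 5 ∧ Mp % 8 = 3 ∧
      0 < Mm ∧ 0 < Mp ∧ Mm + Mp = 4 * z + 4 ∧ z ≤ Nat.sqrt (2 * p) ∧ 0 < z ∧ z + 2 < p := by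
  obtain ⟨s, hs⟩ : ∃ s, s = Nat.sqrt (2 * p) := ⟨_, rfl⟩
  have hs1 : s * s ≤ 2 * p := hs ▸ Nat.sqrt_le (2 * p)
  have hs2 : 2 * p < (s + 1) * (s + 1) := hs ▸ Nat.lt_succ_sqrt (2 * p)
  have hne : s * s ≠ 2 * p := fun h => mul_self_mod_eight_ne_six s (by omega)
  have hs3 : 3 ≤ s := by nlinarith
  have hsp : s + 3 < p := by nlinarith
  -- the odd neighbour below `√(2p)`
  obtain ⟨z, hz2, hzs, hsz⟩ : ∃ z : ℕ, z % 2 = 1 ∧ z ≤ s ∧ s ≤ z + 1 := by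
    by_cases hodd : s % 2 = 1
    · exact ⟨s, hodd, le_rfl, by omega⟩
    · exact ⟨s - 1, by omega, by omega, by omega⟩
  have hzz : z * z < 2 * p := by
    rcases hzs.lt_or_eq with hlt | heq
    · calc z * z < s * s := Nat.mul_self_lt_mul_self hlt
        _ ≤ 2 * p := hs1
    · rw [heq]; omega
  have hzz2 : 2 * p < (z + 2) * (z + 2) := hs2.trans_le (Nat.mul_self_le_mul_self (by omega))
  obtain ⟨Mm, hMm⟩ : ∃ Mm : ℕ, z * z + Mm = 2 * p := ⟨2 * p - z * z, by omega⟩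
  obtain ⟨Mp, hMp⟩ : ∃ Mp : ℕ, 2 * p + Mp = (z + 2) * (z + 2) := ⟨(z + 2) * (z + 2) - 2 * p, by omega⟩
  have hz8 : z * z % 8 = 1 := by rw [← sq]; exact sq_mod_eight_of_odd hz2
  have hp8 : 2 * p % 8 = 6 := by omega
  set w := z * z with hw
  have hsum : Mm + Mp = 4 * z + 4 := by nlinarith
  refine ⟨z, Mm, Mp, hz2, hMm, hMp, by omega, by omega, by omega, by omega, hsum, hs ▸ hzs, by omega, by omega⟩

/-- ★ **THE ROUNDING PIN.** For every prime `p ≡ 3 (mod 4)`, `p ≥ 7`, there is a prime `r ≤ 2⌊√(2p)⌋ + 1` which is a `(3,+)`-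
partner (`r ≡ 3 (mod 8)`, `(r/p) = +1`) or a `(5,−)`-partner (`r ≡ 5 (mod 8)`, `(r/p) = −1`) of `p`: a prime factor `≡ ±3 (mod 8)`
of the SMALLER of `M⁻ = 2p − z²`, `M⁺ = (z+2)² − 2p` (`≤ 2z + 2`). [folklore] -/
theorem roundingPin {p : ℕ} (hp : p.Prime) (hp4 : p % 4 = 3) (h7 : 7 ≤ p) :
    ∃ r : ℕ, r.Prime ∧ r ≤ 2 * Nat.sqrt (2 * p) + 1 ∧
      ((r % 8 = 3 ∧ jacobiSym (r : ℤ) p = 1) ∨ (r % 8 = 5 ∧ jacobiSym (r : ℤ) p = -1)) := by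
  obtain ⟨z, Mm, Mp, _, hMm, hMp, hMm8, hMp8, hMm0, hMp0, hsum, hzs, hz0, hzp⟩ := exists_odd_neighbours hp4 h7
  by_cases hle : Mm ≤ Mp
  · obtain ⟨r, hr, hrM, hr8⟩ := exists_prime_dvd_mod_eight_three_or_five (n := Mm) (Or.inr hMm8)
    have hrle : r ≤ Mm := Nat.le_of_dvd hMm0 hrM
    have hro : r % 2 = 1 := by omega
    refine ⟨r, hr, by omega, type_of_dvd_sq_sub_two_mul hp hp4 hr hr8 (Or.inl hMm) hrM hz0 (by omega)⟩
  · obtain ⟨r, hr, hrM, hr8⟩ := exists_prime_dvd_mod_eight_three_or_five (n := Mp) (Or.inl hMp8)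
    have hrle : r ≤ Mp := Nat.le_of_dvd hMp0 hrM
    have hro : r % 2 = 1 := by omega
    refine ⟨r, hr, by omega, type_of_dvd_sq_sub_two_mul (z := z + 2) hp hp4 hr hr8 (Or.inr hMp) hrM (by omega) hzp⟩

/-- **The rounding pin, card form** (`Ideas/rounding-pin-all-p.md`, «First lemma» `RoundingPin`, VERBATIM): for every prime
`p ≡ 3 (mod 4)` with `p ≥ 23` a prime `r` with `r² < 9p` of type `(3,+)` or `(5,−)` (`(2⌊√2p⌋+1)² < 9p` for `p ≥ 23`).
[folklore] -/
theorem roundingPin_sq_lt : ∀ p : ℕ, p.Prime → p % 4 = 3 → 23 ≤ p →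
    ∃ r : ℕ, r.Prime ∧ r ^ 2 < 9 * p ∧ ((r % 8 = 3 ∧ jacobiSym r p = 1) ∨ (r % 8 = 5 ∧ jacobiSym r p = -1)) := by
  intro p hp hp4 h23
  obtain ⟨r, hr, hrle, htype⟩ := roundingPin hp hp4 (by omega)
  refine ⟨r, hr, ?_, htype⟩
  obtain ⟨s, hs⟩ : ∃ s, s = Nat.sqrt (2 * p) := ⟨_, rfl⟩
  have hs1 : s * s ≤ 2 * p := hs ▸ Nat.sqrt_le (2 * p)
  rw [← hs] at hrle
  have hr2 : r ^ 2 ≤ (2 * s + 1) * (2 * s + 1) := by rw [sq]; exact Nat.mul_self_le_mul_self hrle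
  rcases Nat.lt_or_ge p 34 with hlt | hge
  · have hs8 : s ≤ 8 := by nlinarith
    interval_cases s <;> omega
  · nlinarith

/-! ## §4 The trichotomy -/

/-- ★ **THE ROUNDING TRICHOTOMY.** For a prime `p ≡ 3 (mod 4)`, `p ≥ 7`, with `s = ⌊√(2p)⌋`: EITHER there are a `(3,+)`-partner `q`
and a `(5,−)`-partner `ℓ` with `qℓ ≤ 4(s+1)²` (both types among the prime factors of `M⁺M⁻`; if they divide the same `M`, then
`qℓ ≤ M`), OR a `(3,+)`-partner `q` with `7q ≤ 4s + 1` (no factor `≡ 5`: then `M⁻ ≡ 5 (mod 8)` has factors `≡ 3` and `≡ 7`), OR a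
`(5,−)`-partner `ℓ` with `7ℓ ≤ 4s − 1` (no factor `≡ 3`: then `M⁺ ≡ 3 (mod 8)` has factors `≡ 5` and `≡ 7`). [folklore] -/
theorem roundingTrichotomy {p : ℕ} (hp : p.Prime) (hp4 : p % 4 = 3) (h7 : 7 ≤ p) :
    (∃ q l : ℕ, q.Prime ∧ q % 8 = 3 ∧ jacobiSym (q : ℤ) p = 1 ∧ l.Prime ∧ l % 8 = 5 ∧ jacobiSym (l : ℤ) p = -1 ∧
        q * l ≤ 4 * (Nat.sqrt (2 * p) + 1) ^ 2) ∨
      (∃ q : ℕ, q.Prime ∧ q % 8 = 3 ∧ jacobiSym (q : ℤ) p = 1 ∧ 7 * q ≤ 4 * Nat.sqrt (2 * p) + 1) ∨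
      (∃ l : ℕ, l.Prime ∧ l % 8 = 5 ∧ jacobiSym (l : ℤ) p = -1 ∧ 7 * l ≤ 4 * Nat.sqrt (2 * p) - 1) := by
  obtain ⟨z, Mm, Mp, _, hMm, hMp, hMm8, hMp8, hMm0, hMp0, hsum, hzs, hz0, hzp⟩ := exists_odd_neighbours hp4 h7
  set s := Nat.sqrt (2 * p) with hs
  -- the type of a `±3`-factor of `M⁻` or `M⁺`
  have typ : ∀ r : ℕ, r.Prime → (r ∣ Mm ∨ r ∣ Mp) → (r % 8 = 3 ∨ r % 8 = 5) →
      (r % 8 = 3 ∧ jacobiSym (r : ℤ) p = 1) ∨ (r % 8 = 5 ∧ jacobiSym (r : ℤ) p = -1) := fun r hr hrM hr8 => by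
    rcases hrM with h | h
    · exact type_of_dvd_sq_sub_two_mul hp hp4 hr hr8 (Or.inl hMm) h hz0 (by omega)
    · exact type_of_dvd_sq_sub_two_mul (z := z + 2) hp hp4 hr hr8 (Or.inr hMp) h (by omega) hzp
  have typ3 : ∀ r : ℕ, r.Prime → (r ∣ Mm ∨ r ∣ Mp) → r % 8 = 3 → jacobiSym (r : ℤ) p = 1 := fun r hr hrM h3 => by
    rcases typ r hr hrM (Or.inl h3) with ⟨_, hJ⟩ | ⟨h', _⟩
    · exact hJ
    · omega
  have typ5 : ∀ r : ℕ, r.Prime → (r ∣ Mm ∨ r ∣ Mp) → r % 8 = 5 → jacobiSym (r : ℤ) p = -1 := fun r hr hrM h5 => by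
    rcases typ r hr hrM (Or.inr h5) with ⟨h', _⟩ | ⟨_, hJ⟩
    · omega
    · exact hJ
  have hprod : Mm * Mp ≤ 4 * (s + 1) ^ 2 := by
    have h1 : 4 * (Mm * Mp) ≤ (Mm + Mp) * (Mm + Mp) := by nlinarith [sq_nonneg ((Mm : ℤ) - (Mp : ℤ))]
    rw [hsum] at h1
    have h2 : (4 * z + 4) * (4 * z + 4) ≤ (4 * s + 4) * (4 * s + 4) := Nat.mul_self_le_mul_self (by omega)
    nlinarith
  by_cases h5 : ∃ l : ℕ, l.Prime ∧ (l ∣ Mm ∨ l ∣ Mp) ∧ l % 8 = 5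
  · by_cases h3 : ∃ q : ℕ, q.Prime ∧ (q ∣ Mm ∨ q ∣ Mp) ∧ q % 8 = 3
    · -- both types: `qℓ ≤ M⁺M⁻` (different `M`'s) or `qℓ ≤ M` (same `M`)
      left
      obtain ⟨l, hl, hlM, hl8⟩ := h5
      obtain ⟨q, hq, hqM, hq8⟩ := h3
      have hql : q ≠ l := by rintro rfl; omega
      have hcop : Nat.Coprime q l := (Nat.coprime_primes hq hl).mpr hql
      refine ⟨q, l, hq, hq8, typ3 q hq hqM hq8, hl, hl8, typ5 l hl hlM hl8, ?_⟩
      rcases hqM with hq' | hq' <;> rcases hlM with hl' | hl'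
      · calc q * l ≤ Mm := Nat.le_of_dvd hMm0 (hcop.mul_dvd_of_dvd_of_dvd hq' hl')
          _ ≤ Mm * Mp := Nat.le_mul_of_pos_right _ hMp0
          _ ≤ _ := hprod
      · calc q * l ≤ Mm * Mp := Nat.mul_le_mul (Nat.le_of_dvd hMm0 hq') (Nat.le_of_dvd hMp0 hl')
          _ ≤ _ := hprod
      · calc q * l ≤ Mp * Mm := Nat.mul_le_mul (Nat.le_of_dvd hMp0 hq') (Nat.le_of_dvd hMm0 hl')
          _ = Mm * Mp := Nat.mul_comm _ _
          _ ≤ _ := hprod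
      · calc q * l ≤ Mp := Nat.le_of_dvd hMp0 (hcop.mul_dvd_of_dvd_of_dvd hq' hl')
          _ ≤ Mm * Mp := Nat.le_mul_of_pos_left _ hMm0
          _ ≤ _ := hprod
    · -- only type `(5,−)`: `M⁺ ≡ 3 (mod 8)` has factors `≡ 5` and `≡ 7`, `7ℓ ≤ M⁺ ≤ 4s − 1`
      right; right
      push Not at h3
      obtain ⟨l, s', hl, hlM, hl8, hs', hs'M, hs'8⟩ :=
        exists_prime_dvd_five_and_seven hMp8 fun r hr hrM hr8 => h3 r hr (Or.inr hrM) hr8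
      refine ⟨l, hl, hl8, typ5 l hl (Or.inr hlM) hl8, ?_⟩
      have h7l := seven_mul_le_of_dvd_of_dvd hMp0 hl hs' (by rintro rfl; omega) (by have := hs'.two_le; omega) hlM hs'M
      omega
  · -- only type `(3,+)` (a `±3`-factor exists): `M⁻ ≡ 5 (mod 8)` has factors `≡ 3` and `≡ 7`, `7q ≤ M⁻ ≤ 4s + 1`
    right; left
    push Not at h5
    obtain ⟨q, s', hq, hqM, hq8, hs', hs'M, hs'8⟩ :=
      exists_prime_dvd_three_and_seven hMm8 fun r hr hrM hr8 => h5 r hr (Or.inl hrM) hr8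
    refine ⟨q, hq, hq8, typ3 q hq (Or.inl hqM) hq8, ?_⟩
    have h7q := seven_mul_le_of_dvd_of_dvd hMm0 hq hs' (by rintro rfl; omega) (by have := hs'.two_le; omega) hqM hs'M
    omega

/-! ## §5 The `(3,+)` pin on `p ≡ 7 (mod 8)`, sized `q ≤ 3p + 4⌊√(2p)⌋ + 2` -/

/-- **The `(3,+)` pin, sharp size on `p ≡ 7 (mod 8)`**: a prime `q ≡ 3 (mod 8)` with `(q/p) = +1` and `q ≤ 3p + 4⌊√(2p)⌋ + 2`.
From `exists_indefinite_certificate_threePlus`: `q ∣ p + e²`, `e ≤ 2⌊√X⌋ + 2` off the family `X = ⌊√X⌋²` (`X = ⌊p/2⌋`), and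
that family is EMPTY here since `X = (p−1)/2 ≡ 3 (mod 4)` is not a square; `(2⌊√X⌋)² ≤ 4X < 2p` gives `2⌊√X⌋ ≤ ⌊√(2p)⌋`.
[folklore] -/
theorem indefinitePinThreePlus_sharp {p : ℕ} (hp : p.Prime) (hp8 : p % 8 = 7) :
    ∃ q : ℕ, q.Prime ∧ q % 8 = 3 ∧ jacobiSym (q : ℤ) p = 1 ∧ q ≤ 3 * p + 4 * Nat.sqrt (2 * p) + 2 := by
  have h7 : 7 ≤ p := by have := hp.two_le; omega
  obtain ⟨u, v, e, q, -, -, -, -, -, hq, hqB, hq8, hJ, -, hesmall⟩ :=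
    exists_indefinite_certificate_threePlus hp (by omega) h7
  obtain ⟨r, hr⟩ : ∃ r, r = Nat.sqrt (p / 2) := ⟨_, rfl⟩
  rw [← hr] at hesmall
  have hrr : r * r ≤ p / 2 := hr ▸ Nat.sqrt_le (p / 2)
  have hX : r * r ≠ p / 2 := by
    intro h
    have h4 : (p / 2) % 4 = 3 := by omega
    have hsq : ∀ a < 4, a * a % 4 ≠ 3 := by decide
    exact hsq (r % 4) (Nat.mod_lt r (by norm_num)) (by rw [← Nat.mul_mod, h, h4])
  have he : e ≤ 2 * r + 2 := hesmall hX
  have h2r : 2 * r ≤ Nat.sqrt (2 * p) := by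
    rw [Nat.le_sqrt]
    have : 2 * (p / 2) ≤ p := Nat.mul_div_le p 2
    nlinarith
  refine ⟨q, hq, hq8, hJ, (Nat.le_of_dvd (by positivity) hqB).trans ?_⟩
  have hee : e ^ 2 ≤ (2 * r + 2) * (2 * r + 2) := by rw [sq]; exact Nat.mul_self_le_mul_self he
  have hodd : 2 * (p / 2) + 1 = p := by omega
  nlinarith

/-! ## §6 The cell pair with `|d| = qℓ = O(p^{3/2})` for EVERY prime `p ≡ 7 (mod 8)` -/

/-- ★ **CELL PAIR FOR EVERY PRIME `p ≡ 7 (mod 8)`** (supply half of the `E_p` cell, no residue-class hypothesis): primes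
`q ≡ 3 (mod 8)` with `(q/p) = +1` and `ℓ ≡ 5 (mod 8)` with `(ℓ/p) = −1` such that `7·qℓ ≤ (3p + 4s + 4)(4s + 1)`, `s = ⌊√(2p)⌋`
(so `qℓ < 2.6·p^{3/2}` for `p ≥ 1400`). Trichotomy + `threeSquaresPin` (`ℓ < 2p`) + `indefinitePinThreePlus_sharp`. [folklore] -/
theorem exists_cellPair_bound {p : ℕ} (hp : p.Prime) (hp8 : p % 8 = 7) :
    ∃ q l : ℕ, q.Prime ∧ q % 8 = 3 ∧ l.Prime ∧ l % 8 = 5 ∧ jacobiSym (q : ℤ) p = 1 ∧ jacobiSym (l : ℤ) p = -1 ∧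
      7 * (q * l) ≤ (3 * p + 4 * Nat.sqrt (2 * p) + 4) * (4 * Nat.sqrt (2 * p) + 1) := by
  have h7 : 7 ≤ p := by have := hp.two_le; omega
  have hp4 : p % 4 = 3 := by omega
  obtain ⟨s, hs⟩ : ∃ s, s = Nat.sqrt (2 * p) := ⟨_, rfl⟩
  have hs1 : s * s ≤ 2 * p := hs ▸ Nat.sqrt_le (2 * p)
  have hs2 : 2 * p < (s + 1) * (s + 1) := hs ▸ Nat.lt_succ_sqrt (2 * p)
  have hs3 : 3 ≤ s := by nlinarith
  rw [← hs]
  rcases roundingTrichotomy hp hp4 h7 with ⟨q, l, hq, hq8, hJq, hl, hl8, hJl, hle⟩ | ⟨q, hq, hq8, hJq, hle⟩ |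
      ⟨l, hl, hl8, hJl, hle⟩
  · refine ⟨q, l, hq, hq8, hl, hl8, hJq, hJl, ?_⟩
    rw [← hs] at hle
    nlinarith
  · obtain ⟨l, hl, hllt, hl8, hJl⟩ :=
      Summit.BirchSwinnertonDyer.BirchSwinnertonDyer.Theorems.BiquadraticEisensteinDescentHeegnerTwistCouplingInSupplyThreeSquaresPin.threeSquaresPin
        p hp hp4
    refine ⟨q, l, hq, hq8, hl, hl8, hJq, hJl, ?_⟩
    rw [← hs] at hle
    calc 7 * (q * l) = (7 * q) * l := by ring
      _ ≤ (4 * s + 1) * (3 * p + 4 * s + 4) := Nat.mul_le_mul hle (by omega)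
      _ = (3 * p + 4 * s + 4) * (4 * s + 1) := Nat.mul_comm _ _
  · obtain ⟨q, hq, hq8, hJq, hqle⟩ := indefinitePinThreePlus_sharp hp hp8
    refine ⟨q, l, hq, hq8, hl, hl8, hJq, hJl, ?_⟩
    rw [← hs] at hle hqle
    have h7l : 7 * l ≤ 4 * s + 1 := by omega
    calc 7 * (q * l) = q * (7 * l) := by ring
      _ ≤ (3 * p + 4 * s + 4) * (4 * s + 1) := Nat.mul_le_mul (by omega) h7l

end Summit.BirchSwinnertonDyer.BirchSwinnertonDyer.Theorems.BiquadraticEisensteinDescentHeegnerTwistCouplingInSupplyRoundingPin
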